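import Literature.AlgebraicGeometry.Resolution.Prop81HeadExtraction
import HarnessLib

/-!
# [CoP1] Prop. 8.1: extraction from the final monomial state, keeping the tracked element `F`

Topic: `Literature/AlgebraicGeometry/Resolution` (proofs only; no new notions, no new named
facts). `Prop81HeadExtraction.lean` (`head_conclusion_of_finalState`) passes from the final state
of the monoidal loops of [CoP1] Prop. 8.1 (V. Cossart, O. Piltant, HAL hal-00139124, pp. 22–23,
27) to the head of Prop. 9.3, exporting in its clause (c′) SOME monomial `f₁ ∈ R₁′` tracking the
generators — in its proof `f₁` is the tracked element `F` itself, but the statement forgets this.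
Cossart–Piltant 2019's descent (J. Algebra 529 (2019) = arXiv:1412.0868, proof of Prop. 4.8,
(510)–(512)) needs the final monomial form OF `F` (the denominators of the model divide a power
of `F`, hence are units times monomials, which yields the shape elements of (512)). This file
re-proves the extraction with clause (c′) stated for `F`:

* `head_conclusion_of_finalState_F` — as `head_conclusion_of_finalState`, with (c′) reading
  `F = w′ ∏_{i<r} x′ᵢ^{eᵢ}` and `Fⁿ t″ ⊆ R₁′`; proof verbatim.

## Sources

* V. Cossart, O. Piltant, J. Algebra 320 (2008) 1051–1082: Prop. 8.1 and the proof of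
  Prop. 9.3 up to (47) (HAL hal-00139124, pp. 22, 27–28). [CossartPiltant2008]
* V. Cossart, O. Piltant, J. Algebra 529 (2019) 268–535 = arXiv:1412.0868, proof of Prop. 4.8,
  (510)–(512) (arXiv v1: Prop. 4.6, p. 53). [CossartPiltant2019]
-/

noncomputable section

namespace Literature.AlgebraicGeometry.Resolution

universe u

open IsLocalRing Function

section ExtractionF

variable {S : Type u} [CommRing S] {E : Type u} [Field E] [Algebra S E]
  (OE : ValuationSubring E)

set_option maxHeartbeats 1600000 in
/-- **From the final monomial state to the head of [CoP1] Prop. 9.3, keeping `F`.** As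
`head_conclusion_of_finalState` (renumbering of the regular parameters so that the support `E′`
becomes `{0, …, r-1}`, `♯E′ = r` by (33), (a) from the monomial generator `h` of `𝔪_{R₁′} S′`,
(b) with `det ≠ 0` from the independence of the values of the `fᵢ`), with (c′) stated for the
tracked element `F` itself: `F = w′ ∏_{i<r} x′ᵢ^{eᵢ}` with `w′` a unit, and `Fⁿ t″ ⊆ R₁′`.
[cite: CossartPiltant2008, Prop. 8.1 and proof of Prop. 9.3 (HAL pp. 22, 27)]
[cite: CossartPiltant2019, proof of Prop. 4.8, (510)–(512) (arXiv v1: Prop. 4.6, p. 53)] -/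
theorem head_conclusion_of_finalState_F (M K' : Subfield E) (A : Subring E) (B₀ : Subalgebra S E)
    (t' : Set E) (ht' : t'.Finite) (ht'K : t' ⊆ K')
    (hT'O : (Algebra.adjoin S t').toSubring ≤ OE.toSubring) (hB₀ : B₀ ≤ Algebra.adjoin S t')
    (hreg : IsRegularLocalRing (locAtCentre (Algebra.adjoin S t').toSubring OE))
    (x : Fin 3 → locAtCentre (Algebra.adjoin S t').toSubring OE) (hx0 : ∀ j, (x j : E) ≠ 0)
    (hx : haveI := isLocalRing_locAtCentre hT'O
      Ideal.span (Set.range x) = maximalIdeal _)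
    (E' : Finset (Fin 3)) (r : ℕ) (hr0 : 0 < r) (hcard : E'.card ≤ r)
    (F u : E) (huR : u ∈ locAtCentre (Algebra.adjoin S t').toSubring OE)
    (hvu : OE.valuation u = 1) (αF : Fin 3 → ℕ) (hαF : ∀ c, c ∉ E' → αF c = 0)
    (hF : F = u * ∏ c, (x c : E) ^ αF c) (hTR : ∀ z ∈ t', ∃ n : ℕ, F ^ n * z ∈ A)
    (h w : E) (hwR : w ∈ locAtCentre (Algebra.adjoin S t').toSubring OE)
    (β : Fin 3 → ℕ) (hβ : ∀ c ∈ E', 0 < β c)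
    (hh : h = w * ∏ c, (x c : E) ^ β c)
    (hdomA : ∀ y ∈ A, OE.valuation y < 1 →
      ∃ c ∈ locAtCentre (Algebra.adjoin S t').toSubring OE, y = h * c)
    (f γ : Fin r → E) (hfM : ∀ i, f i ∈ M)
    (hγR : ∀ i, γ i ∈ locAtCentre (Algebra.adjoin S t').toSubring OE)
    (hvγ : ∀ i, OE.valuation (γ i) = 1)
    (a : Fin r → Fin 3 → ℕ) (hsuppa : ∀ i c, c ∉ E' → a i c = 0)
    (hfa : ∀ i, f i = γ i * ∏ c, (x c : E) ^ a i c)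
    (hind : ∀ p m : Fin r → ℕ, ∏ i, OE.valuation (f i) ^ p i = ∏ i, OE.valuation (f i) ^ m i →
      p = m) :
    ∃ (t'' : Finset E) (_ : (t'' : Set E) ⊆ K')
      (hTO' : (Algebra.adjoin S (t'' : Set E)).toSubring ≤ OE.toSubring)
      (_ : B₀ ≤ Algebra.adjoin S (t'' : Set E))
      (_ : IsRegularLocalRing (locAtCentre (Algebra.adjoin S (t'' : Set E)).toSubring OE))
      (r' : ℕ) (hr' : r' ≤ 3) (_ : 0 < r')
      (x' : Fin 3 → locAtCentre (Algebra.adjoin S (t'' : Set E)).toSubring OE),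
      (∀ j, ((x' j : locAtCentre (Algebra.adjoin S (t'' : Set E)).toSubring OE) : E) ≠ 0) ∧
      (haveI := isLocalRing_locAtCentre hTO'
       Ideal.span (Set.range x') =
         maximalIdeal (locAtCentre (Algebra.adjoin S (t'' : Set E)).toSubring OE)) ∧
      (∀ y : locAtCentre (Algebra.adjoin S (t'' : Set E)).toSubring OE,
        (y : E) ∈ A → OE.valuation (y : E) < 1 →
        y ∈ Ideal.span {∏ i : Fin r', x' (Fin.castLE hr' i)}) ∧
      (∃ (f' : Fin r' → E)
          (γ' : Fin r' → (locAtCentre (Algebra.adjoin S (t'' : Set E)).toSubring OE)ˣ)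
          (a' : Matrix (Fin r') (Fin r') ℕ),
        (∀ i, f' i ∈ M) ∧
        (∀ i, f' i = ((γ' i : locAtCentre (Algebra.adjoin S (t'' : Set E)).toSubring OE) : E) *
          ∏ j, ((x' (Fin.castLE hr' j) :
            locAtCentre (Algebra.adjoin S (t'' : Set E)).toSubring OE) : E) ^ a' i j) ∧
        (a'.map (fun n : ℕ => (n : ℤ))).det ≠ 0) ∧
      (∃ (w' : (locAtCentre (Algebra.adjoin S (t'' : Set E)).toSubring OE)ˣ)
          (e : Fin r' → ℕ),
        F = ((w' : locAtCentre (Algebra.adjoin S (t'' : Set E)).toSubring OE) : E) *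
          ∏ i, ((x' (Fin.castLE hr' i) :
            locAtCentre (Algebra.adjoin S (t'' : Set E)).toSubring OE) : E) ^ e i) ∧
      (∀ z ∈ (t'' : Set E), ∃ n : ℕ, F ^ n * z ∈ A) := by
  classical
  -- replace `t'` by a finset
  obtain ⟨t'', rfl⟩ : ∃ t'' : Finset E, (t'' : Set E) = t' := ⟨ht'.toFinset, ht'.coe_toFinset⟩
  haveI := isLocalRing_locAtCentre hT'O
  -- values of the `fᵢ`
  have hvf : ∀ i, OE.valuation (f i) = ∏ c, OE.valuation (x c : E) ^ a i c := by
    intro i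
    rw [hfa i, map_mul, hvγ i, one_mul, map_prod]
    exact Finset.prod_congr rfl fun c _ => map_pow _ _ _
  -- (33): `♯E′ = r`, hence `r ≤ 3`
  have hrle : r ≤ E'.card :=
    le_card_of_independent (fun i => OE.valuation (f i)) (fun c => OE.valuation (x c : E)) a hvf
      hind E' hsuppa
  have hcardE : E'.card = r := le_antisymm hcard hrle
  have hr3 : r ≤ 3 := by
    have := Finset.card_le_univ E'
    rw [Fintype.card_fin] at this
    omega
  -- the renumbering `σ` with `σ {0,…,r-1} = E′`
  have hc1 : Fintype.card {c : Fin 3 // (c : ℕ) < r} = Fintype.card {c : Fin 3 // c ∈ E'} := by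
    rw [Fintype.card_fin_lt_of_le hr3, Fintype.card_coe, hcardE]
  let eσ : {c : Fin 3 // (c : ℕ) < r} ≃ {c : Fin 3 // c ∈ E'} := Fintype.equivOfCardEq hc1
  let σ : Equiv.Perm (Fin 3) := eσ.extendSubtype
  let ι : Fin r → Fin 3 := fun i => σ (Fin.castLE hr3 i)
  have hιmem : ∀ i, ι i ∈ E' := fun i =>
    eσ.extendSubtype_mem _ i.2
  have hιinj : Injective ι := fun i j hij => by
    have := σ.injective hij
    exact Fin.castLE_injective hr3 this
  have hιsurj : ∀ c ∈ E', ∃ i, ι i = c := by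
    intro c hc
    obtain ⟨⟨c₀, hc₀⟩, hc₀e⟩ := eσ.surjective ⟨c, hc⟩
    refine ⟨⟨c₀, hc₀⟩, ?_⟩
    have h1 : Fin.castLE hr3 ⟨(c₀ : ℕ), hc₀⟩ = c₀ := Fin.ext rfl
    simp only [ι, h1, σ, eσ.extendSubtype_apply_of_mem _ hc₀, hc₀e]
  have hιrange : ∀ c, c ∉ Set.range ι → c ∉ E' := fun c hc hcE => by
    obtain ⟨i, hi⟩ := hιsurj c hcE
    exact hc ⟨i, hi⟩
  -- reindexing of monomials supported in `E′`
  have hreidx : ∀ δ : Fin 3 → ℕ, (∀ c, c ∉ E' → δ c = 0) →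
      (∏ c, (x c : E) ^ δ c) = ∏ i : Fin r, (x (ι i) : E) ^ δ (ι i) := by
    intro δ hδ
    rw [← Finset.prod_subset (Finset.subset_univ E')
      (fun c _ hc => by rw [hδ c hc, pow_zero])]
    symm
    refine Finset.prod_bij (fun i _ => ι i) (fun i _ => hιmem i)
      (fun i _ j _ hij => hιinj hij) (fun c hc => ?_) (fun i _ => rfl)
    obtain ⟨i, hi⟩ := hιsurj c hc
    exact ⟨i, Finset.mem_univ _, hi⟩
  -- the renumbered parameters
  let x' : Fin 3 → locAtCentre (Algebra.adjoin S (t'' : Set E)).toSubring OE := fun c => x (σ c)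
  have hx'ι : ∀ i : Fin r, x' (Fin.castLE hr3 i) = x (ι i) := fun i => rfl
  have hx'span : Ideal.span (Set.range x') = maximalIdeal _ := by
    rw [← hx]
    congr 1
    exact σ.surjective.range_comp x
  -- units of the local ring from elements of value `0`
  have hunit : ∀ (y : E) (hy : y ∈ locAtCentre (Algebra.adjoin S (t'' : Set E)).toSubring OE),
      OE.valuation y = 1 →
      IsUnit (⟨y, hy⟩ : locAtCentre (Algebra.adjoin S (t'' : Set E)).toSubring OE) := by
    intro y hy hvy
    by_contra hnu
    have := (not_isUnit_locAtCentre_iff hT'O ⟨y, hy⟩).mp hnu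
    rw [hvy] at this
    exact lt_irrefl _ this
  refine ⟨t'', ht'K, hT'O, hB₀, hreg, r, hr3, hr0, x', fun j => hx0 _, hx'span, ?_, ?_, ?_, hTR⟩
  · -- (a)
    intro y hyA hvy
    obtain ⟨c, hcR, hyc⟩ := hdomA y hyA hvy
    -- `h = w · (∏_{c ∈ E′} x_c) · x^{β - 1_{E′}}`
    let β₁ : Fin 3 → ℕ := fun c => if c ∈ E' then β c - 1 else β c
    let χ : Fin 3 → ℕ := fun c => if c ∈ E' then 1 else 0
    have hβsplit : ∀ c, β c = χ c + β₁ c := fun c => by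
      by_cases hc : c ∈ E'
      · simp only [χ, β₁, hc, if_true]; have := hβ c hc; omega
      · simp only [χ, β₁, hc, if_false, zero_add]
    have hprodχ : (∏ c, (x c : E) ^ χ c) = ∏ i : Fin r, (x (ι i) : E) := by
      rw [hreidx χ (fun c hc => by simp only [χ, hc, if_false])]
      refine Finset.prod_congr rfl fun i _ => ?_
      simp only [χ, hιmem i, if_true, pow_one]
    have hP : ((∏ i : Fin r, x' (Fin.castLE hr3 i) :
        locAtCentre (Algebra.adjoin S (t'' : Set E)).toSubring OE) : E) =
        ∏ i : Fin r, (x (ι i) : E) := by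
      rw [SubmonoidClass.coe_finsetProd]
    refine Ideal.mem_span_singleton'.mpr
      ⟨⟨w, hwR⟩ * (∏ c, x c ^ β₁ c) * ⟨c, hcR⟩, Subtype.ext ?_⟩
    change ((⟨w, hwR⟩ * (∏ c, x c ^ β₁ c) * ⟨c, hcR⟩ :
        locAtCentre (Algebra.adjoin S (t'' : Set E)).toSubring OE) : E) *
      ((∏ i : Fin r, x' (Fin.castLE hr3 i) :
        locAtCentre (Algebra.adjoin S (t'' : Set E)).toSubring OE) : E) = (y : E)
    rw [hP, hyc, hh, Subring.coe_mul, Subring.coe_mul, SubmonoidClass.coe_finsetProd]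
    simp only [SubmonoidClass.coe_pow]
    rw [← hprodχ, show (∏ c, (x c : E) ^ β c) = (∏ c, (x c : E) ^ χ c) * ∏ c, (x c : E) ^ β₁ c by
      rw [← Finset.prod_mul_distrib]
      exact Finset.prod_congr rfl fun c _ => by rw [← pow_add, hβsplit c]]
    ring
  · -- (b)
    have hγu : ∀ i, (((hunit (γ i) (hγR i) (hvγ i)).unit :
        locAtCentre (Algebra.adjoin S (t'' : Set E)).toSubring OE) : E) = γ i := fun i => by
      rw [IsUnit.unit_spec]
    refine ⟨f, fun i => (hunit (γ i) (hγR i) (hvγ i)).unit,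
      Matrix.of fun i j => a i (ι j), hfM, fun i => ?_, ?_⟩
    · rw [hfa i, hreidx (a i) (hsuppa i), hγu i]
      simp only [Matrix.of_apply, hx'ι]
    · have hdet := det_ne_zero_of_independent (fun i => OE.valuation (f i))
        (fun c => OE.valuation (x c : E)) a hvf hind ι (fun i c hc => hsuppa i c (hιrange c hc))
      have hmat : (Matrix.of fun i j => a i (ι j)).map (fun n : ℕ => (n : ℤ)) =
          Matrix.of fun i j => ((a i (ι j) : ℕ) : ℤ) := by
        ext i j; rfl
      rw [hmat]
      exact hdet
  · -- (c′)
    have huu : (((hunit u huR hvu).unit :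
        locAtCentre (Algebra.adjoin S (t'' : Set E)).toSubring OE) : E) = u := by
      rw [IsUnit.unit_spec]
    refine ⟨(hunit u huR hvu).unit, fun i => αF (ι i), ?_⟩
    rw [hF, hreidx αF hαF, huu]

end ExtractionF

end Literature.AlgebraicGeometry.Resolution

end
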